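import Summits.QuantumFields.YangMills.Theorems.DiagonalMirrorRPROddTorusSwapPairingDefs
import Summits.QuantumFields.YangMills.Theorems.MirrorModularBoostsHypercubicLimitSubschemeDefs
import Literature.MathematicalPhysics.QuantumFieldTheory.GaugeOSData
import Literature.MathematicalPhysics.QuantumFieldTheory.Balaban1983to89.InfiniteVolumeSufficientIV
import Literature.MathematicalPhysics.QuantumFieldTheory.LatticeGaugeStaticPotentialProofs

/-!
# Sketch — crux-ideate ⟨stmt-QuantumFields-27395⟩ `WeakCouplingHypercubicLimitRP`, idea `volume-first-phase-uniqueness`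

First-lemma signatures only (ideation stage; the two `stub_` theorems are NOT proved here).  Vocabulary:
`IsSwapRPState μ` (site-diagonal swap reflection positivity of a state on `ℤ⁴` gauge fields),
`LimitSwapRP r β` (every odd-torus limit state at coupling `β` is swap-RP), `TIPhaseUnique r β`
(`|𝒢_θ(β)| ≤ 1`, tree `ymGibbsMeasuresTI`), `enlarge sch L' hL` (volume surgery of a scheme).
Nothing here is a claim about the Yang–Mills mass gap.
-/

set_option autoImplicit false

noncomputable section

open scoped SchwartzMap
open MeasureTheory Filter Topology
open Literature.MathematicalPhysics.QuantumLattice Literature.MathematicalPhysics.AQFT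
  Literature.MathematicalPhysics.QuantumFieldTheory Literature.Probability.LatticeModels
open Summit.QuantumFields.YangMills.Cruxes.HypercubicLimit.CouplingResponse (subseq)
open Summit.QuantumFields.YangMills.Cruxes.DiagonalMirrorRPR.SignTwistedDiagonalTrace (OddTorusSwapPairingLiminf)

namespace Summit.QuantumFields.YangMills.Cruxes.WeakCouplingHypercubicLimitRP.VolumeFirst

variable {G : Type} [Group G] [TopologicalSpace G] [IsTopologicalGroup G] [CompactSpace G]
  [MeasurableSpace G] [BorelSpace G]

/-- The CLOSED positive half of the site-diagonal mirror `x₀ ↔ x₁` on `ℤ⁴`: positively oriented links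
`(x, i)` with both endpoints in `{x₁ ≤ x₀}`. -/
def diagPosHalf : Set (Literature.MathematicalPhysics.QuantumLattice.ZdEdge 4) :=
  {e | e.1 1 ≤ e.1 0 ∧
    (e.1 + (Pi.single e.2 1 : Site 4)) (1 : Fin 4) ≤ (e.1 + (Pi.single e.2 1 : Site 4)) (0 : Fin 4)}

/-- **Swap reflection positivity of a state** `μ` on `ℤ⁴` gauge fields (mirror through SITES `x₀ = x₁`,
`Θ = configPermZd (0 1)`): `0 ≤ ∫ F(ΘU) F(U) dμ` for every continuous cylinder observable of the closed
positive half. -/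
def IsSwapRPState (μ : Measure (LGConfig 4 G)) : Prop :=
  ∀ (F : LGConfig 4 G → ℝ) (S : Finset (Literature.MathematicalPhysics.QuantumLattice.ZdEdge 4)), (↑S : Set (Literature.MathematicalPhysics.QuantumLattice.ZdEdge 4)) ⊆ diagPosHalf →
    IsCylinder F S → Continuous F →
      0 ≤ ∫ U, F (configPermZd (Equiv.swap (0 : Fin 4) 1) U) * F U ∂μ

/-- **LETTER, weakest form** — `LimitSwapRP r β`: every infinite-volume limit state along odd symmetric
tori at the FIXED coupling `β` is swap-reflection-positive.  (Closed and CONVEX in `μ`.) -/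
def LimitSwapRP (r : LatticeRep G) (β : ℝ) : Prop :=
  ∀ μ ∈ oddTorusLimitPoints r β, IsSwapRPState μ

/-- **LETTER, phase form** — `TIPhaseUnique r β`: at most one translation-invariant DLR state of the Wilson
theory at coupling `β` (tree `ymGibbsMeasuresTI`; `⟺` no local source kink of the pressure, tree
`forall_hasNoLocalSourceKink_iff_subsingleton_ymGibbsMeasuresTI`). -/
def TIPhaseUnique (r : LatticeRep G) (β : ℝ) : Prop :=
  (ymGibbsMeasuresTI (d := 4) r.ρ β).Subsingleton

/-- **Volume surgery**: the same scheme with larger torus half-sides `L' ≥ L` (still a scheme: `a_k L'_k → ∞`). -/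
def enlarge {ι : Type} (sch : SpeciesScheme ι) (L' : ℕ → ℕ) (hL : ∀ k, sch.L k ≤ L' k) : SpeciesScheme ι where
  a := sch.a
  a_pos := sch.a_pos
  tendsto_a := sch.tendsto_a
  β := sch.β
  L := L'
  tendsto_L := tendsto_atTop_mono
    (fun k => mul_le_mul_of_nonneg_left (by exact_mod_cast hL k) (sch.a_pos k).le) sch.tendsto_L
  c := sch.c
  m := sch.m

/-- **FIRST LEMMA (volume sparsification; size L, pure bookkeeping + compactness).**  If the odd-torus limit
states are swap-RP at the witness couplings `β_k` for infinitely many `k`, then after passing to those `k` and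
ENLARGING the tori (diagonal argument: at step `k` the own-torus expectations of all degree-`≤ k` curvature
polynomials supported in the ball of radius `k` are `1/k`-close to those of one limit state `μ_k`), the
own-torus swap socket `OddTorusSwapPairingLiminf` holds for the surgered scheme.  No renormalisation rate, no
`PolyVolume`, no gap is used. -/
theorem stub_socket_of_limitSwapRP (r : LatticeRep G) (sch : SpeciesScheme (YMSpecies G))
    (hU : ∃ᶠ k in atTop, LimitSwapRP r (sch.β k)) :
    ∃ (φ : ℕ → ℕ) (hφ : StrictMono φ) (L' : ℕ → ℕ) (hL : ∀ k, (subseq sch φ hφ).L k ≤ L' k),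
      OddTorusSwapPairingLiminf r (enlarge (subseq sch φ hφ) L' hL) := by
  sorry

/-- **SECOND LEMMA (phase uniqueness ⇒ limit swap-RP; size M–L).**  At `β ≥ 0`, if the translation-invariant
DLR state is unique then every odd-torus limit state is swap-RP: it coincides with every limit state of the
45°-TILTED tori (boundaryless, translation-invariant, DLR), which are exactly swap-RP torus by torus
(Literature `TiltedTorusRP.integral_conj_swap_mul_nonneg`, FILS Thm 2.1), and `IsSwapRPState` is weakly closed. -/
theorem stub_limitSwapRP_of_tiPhaseUnique (r : LatticeRep G) {β : ℝ} (hβ : 0 ≤ β)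
    (hU : TIPhaseUnique r β) : LimitSwapRP r β := by
  sorry

omit [IsTopologicalGroup G] [CompactSpace G] [BorelSpace G] in
/-- Sanity (convexity of the letter's cone): swap-RP states are closed under mixtures. -/
theorem isSwapRPState_add {μ ν : Measure (LGConfig 4 G)} [IsFiniteMeasure μ] [IsFiniteMeasure ν]
    (hμ : IsSwapRPState μ) (hν : IsSwapRPState ν)
    (hint : ∀ (F : LGConfig 4 G → ℝ), Continuous F →
      Integrable (fun U => F (configPermZd (Equiv.swap (0 : Fin 4) 1) U) * F U) μ ∧
      Integrable (fun U => F (configPermZd (Equiv.swap (0 : Fin 4) 1) U) * F U) ν) :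
    IsSwapRPState (μ + ν) := by
  intro F S hS hcyl hcont
  rw [integral_add_measure (hint F hcont).1 (hint F hcont).2]
  exact add_nonneg (hμ F S hS hcyl hcont) (hν F S hS hcyl hcont)

end Summit.QuantumFields.YangMills.Cruxes.WeakCouplingHypercubicLimitRP.VolumeFirst

end
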